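import Summits.QuantumFields.YangMills.Theorems.BalabanUVNodesN06Thm312313ParLawsQ
import Literature.MathematicalPhysics.QuantumFieldTheory.Balaban1983to89.B9Eq3124HZKnitPairReg335Y
import Literature.MathematicalPhysics.QuantumFieldTheory.Balaban1983to89.Node00.OpsYRecordV11Thresh

/-!
# BalabanUVNodes ∕ N06 ([B9], `Dag.B9_main`) — CASCADE-K PIECE K2, GUARD EDITION «G» OF THE ROWS-20∕21 LAW `hC1T` AT THE KNIT PAIR OF RECORD
# (⚑ LOCATED-30, node00-def-Y ruling (α), S1 shape): `…N06Thm312313ParLawsQ.hC1T_knit_of_laws` with its member law `hΔ2` RE-KEYED from the SU(N)-wide shape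
# `(∀ μ z, U μ z ∈ SU(N)) → IsSymmTr 1 (Δ⁽²⁾ x U)` (NO inhabitant at the θ-record: the knit `Δ⁽²⁾` is real only on (3.35)) to the (3.35)-GUARDED shape of the
# Sect.-D network «KD′» (`…N06AtOpsYSectEStKnitSectDKDG.t312_t313_opsYSectESt_knit_KDG`'s displayed binder `hΔ2`, VERBATIM), and with the member law `hparK`
# (knit legs `U(N)`-valued) DISCHARGED on (3.35) from the certificate's regime bridge `hRP1` and the x-free knit numerics ([5] Prop. 2 at the retraction, F5).

Track A of `YM-PLAN.md` (cell `pub-ymgap`, HUMAN RULING D-0062), node **N06** = [Balaban1985BackgroundPropagators] Thms 3.1–3.15; bundle F7 rows 20–21, seat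
`pub-ymgap-dag-n06-l` (g40).  WHY.  «KD′» (✓p794292) DISPLAYS the rows-20∕21 law `hC1TK : ∀ x, M12 ≤ M → ∀ α₀ > 0, M·α₀ ≤ a12 → ∀ U, Reg335 c α₀ U → Reg336 c α₀ U →
IsTransposePair ((𝔬12 x).C1 U) ((𝔬12 x).C1 U)` (the symmetry of `C₁ = (𝔮G₁𝔮⋆)⁻¹`, (3.132), in dag-n06-d's real coordinates) next to the guarded reality law
`hΔ2 : ∀ x, M12 ≤ M → ∀ α₀ > 0, M·α₀ ≤ a12 → ∀ U, Reg335 c α₀ U → IsSymmTr 1 ((𝔯 x).Δ2 U)` (node00-def-Y's S1 shape; record inhabitant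
`Node00.OpsYDelta2FormQ.resYOfRecordPK_Δ2_isSymmTr_SU_threshK` + `hRP1`).  The next composer «KE» folds `hC1TK` into its named inhabitant; the g37 inhabitant
`hC1T_knit_of_laws` asks `hΔ2` in the SU(N)-WIDE shape and would re-open LOCATED-30 there.  THIS FILE is the guard edition: §1 ★ `hparK_knit_of_pinsR` — the member
law `hparK` of `hC1T_knit_of_laws` (knit legs `parKnitY U z w ∈ U(N)` on the classes) INHABITED from «KD′»'s own binders `hRP1` (regime bridge
to print's member class `bg9YP … c35Y`), the x-free knit numerics `0 < α₀′`, `C₀α₀′ ≤ 1∕3`, `2α₀′ ≤ c₂′` and the plaquette threshold `K_pl(a)·L⁴ < α₀′` for `a ≤ a12`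
(F5 `B9Eq3124HZKnitPairReg335Y.parKnitY_mem_unitary_of_reg335P`); §2 ★★★ `hC1T_knit_of_lawsG` — «KD′»'s `hC1TK` VERBATIM (generic `Δ2`, any Sect.-D record `𝔬12` pinned by
`hC1co12` to def-Y's knit model) from `hparK` and the GUARDED `hΔ2`; ★★★ `hC1T_knit_of_pinsG` — the same with `hparK` discharged by §1 (inputs = «KD′»'s binders
`hGR hC1co12 hRP1 hαK hαK3 hαK2` + the member-keyed threshold `hKpl` + the guarded `hΔ2`); §3 ★★★ `hC1T_knit_of_pinsG_res` — at `Δ2 := fun x => (𝔯 x).Δ2` for a residual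
record `𝔯 : ResY N θ M⋆`, binder texts `hC1co12 ∕ hΔ2` = «KD′»'s lines verbatim (one named-argument application for «KE»); ★★★ `hC1T_knit_of_pinsG_resK` — the same
with «KD′»'s index-keyed threshold `hKplK` and `h12K : a12 ≤ aK` (every argument a «KD′» binder by name).
HONEST FRAMING.  Kernel bookkeeping over landed modules (✓`…ParLawsQ`, F5, def-Y's threshold kit); the guarded `hΔ2` is a HYPOTHESIS (inhabited at the record by
def-Y's theorem, not here); nothing of [B9]'s estimates asserted; COUNT-NEUTRAL; N06 NOT discharged; one finite 𝕋⁴ programme at fixed `ε` — NOT continuum, NOT OS,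
NOT the mass gap ∕ Clay.  0 `def`, 0 `sorry`, no `instance`, no `notation`.  NEW file (sibling of ✓`…ParLawsQ`; parent untouched).
RELATED, NOT DUPLICATED (searched 2026-08-30: `rg -l -w "ParLawsQG|hC1T_knit_of_lawsG|hC1T_knit_of_pinsG|hC1T_knit_of_pinsG_res|hC1T_knit_of_pinsG_resK|hparK_knit_of_pinsR"` over `lean/{Literature,Summits,HarnessLib}` = ∅):
✓`…N06Thm312313ParLawsQ` (`hC1T_knit_of_laws`, SU(N)-wide `hΔ2` — superseded for «KE» by §2, stays for SU(N)-wide consumers), ✓`…N06AtOpsYSectEStKnitSectDKDG` («KD′»,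
the consumer shape; its `hlawK` derives the same legs law inline via `…WalkLettersAtRecordROPar.laws_parKnitY_of_reg335P`), ✓`…N06Thm312313AtPinsStateSUCLEParG` ∕
✓`…N06C1L2LegAtPinsRPt` (the g39 guard editions (F1)∕(F2) of the same ruling), def-Y `Node00.OpsYDelta2FormQ` (the record inhabitant of the guarded `hΔ2`).
-/

noncomputable section

namespace Summit.QuantumFields.YangMills.BalabanUVNodes.N06Thm312313ParLawsQG

open scoped Matrix.Norms.L2Operator
open Literature.MathematicalPhysics.QuantumFieldTheory.Balaban1983to89
open Literature.MathematicalPhysics.QuantumFieldTheory.Balaban1983to89.Node00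
open Literature.MathematicalPhysics.QuantumFieldTheory.Balaban1983to89.B6KLevelCensusIndexV1 (KIdx kGeo)
open Literature.MathematicalPhysics.QuantumFieldTheory.Balaban1983to89.B9PinMembersKLevelV1 (MemberY geo9Y bg9Y)
open Literature.MathematicalPhysics.QuantumFieldTheory.Balaban1983to89.B9BackgroundsKLevelV1P (bg9KP bg9YP)
open Literature.MathematicalPhysics.QuantumFieldTheory.Balaban1983to89.B9C2FormBoxRegimeY (Kpl)
open Literature.MathematicalPhysics.QuantumFieldTheory.Balaban1983to89.B9BackgroundsKLevelV1R (RegFamY bg9YR MemOfFam mem_of_reg335R)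
open Literature.MathematicalPhysics.QuantumFieldTheory.Balaban1983to89.B9PinGeometryKLevelV1 (c35Y c35Y_eq)
open Literature.MathematicalPhysics.QuantumFieldTheory.Balaban1983to89.B7Prop2SpecialUnitary (specialUnitaryUnits specialUnitaryUnits_le_unitaryUnits)
open Literature.MathematicalPhysics.QuantumFieldTheory.Balaban1983to89.B7Prop2Explicit (C0 c2')
open Literature.MathematicalPhysics.QuantumFieldTheory.Balaban1983to89.B9CoReadingCoordsTranspose (TrIdx trBasis)
open Literature.MathematicalPhysics.QuantumFieldTheory.Balaban1983to89.B9CoReadingCoordsH (XHK)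
open Literature.MathematicalPhysics.QuantumFieldTheory.Balaban1983to89.B9Thm312Whole (Ops)
open Literature.MathematicalPhysics.QuantumFieldTheory.Balaban1983to89.B9Thm37Glue (IsTransposePair)
open Literature.MathematicalPhysics.QuantumFieldTheory.Balaban1983to89.B9Thm311ReadingCoords (IsSymmTr)
open Literature.MathematicalPhysics.QuantumFieldTheory.Balaban1983to89.B9B8AveragingJunction (parKnitY)
open Literature.MathematicalPhysics.QuantumFieldTheory.Balaban1983to89.B9Eq3124HZKnitPairReg335Y (parKnitY_mem_unitary_of_reg335P)
open Literature.MathematicalPhysics.QuantumFieldTheory.Balaban1983to89.Node00.OpsYOps312OfRecordPar (C1coKq)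
open Literature.MathematicalPhysics.QuantumFieldTheory.Balaban1983to89.Node00.OpsYQLetter (qKnitOfRecord qsKnitOfRecord)
open Summit.QuantumFields.YangMills.BalabanUVNodes.N06Thm312313ParLawsQ (isTransposePair_C1coKq_knit_of_laws)

variable {N : ℕ} [Nonempty (Fin N)] (θ : Stage3Params) (Mstar : ℕ)
  {R₁ R₂ : RegFamY θ.d₆ θ.ℓ₆ θ.hd' θ.hL' θ.b₀ θ.b₁ Mstar (Matrix (Fin N) (Fin N) ℂ)} {c : ℝ}

/-! ## §1 The member law `hparK` (knit legs `U(N)`-valued on the classes) from «KD′»'s regime bridge and the x-free knit numerics -/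

/-- ★ **THE MEMBER LAW `hparK` OF `hC1T_knit_of_laws`, INHABITED ON (3.35)**: over the class-parametric carrier `bg9YR … R₁ R₂`, the
certificate's regime bridge `hRP1` to print's member class `(bg9YP … SU(N) x).Reg335 c35Y α₀` (whose `{Ω_j}`-half is `(bg9KP … x.toKIdx).Reg335 c35Y α₀`), the x-free
knit numerics `0 < α₀′`, `C₀α₀′ ≤ 1∕3`, `2α₀′ ≤ c₂′` and the plaquette threshold `K_pl(a)·L⁴ < α₀′` for `0 ≤ a ≤ a12` make every knit leg `parKnitY U z w` unitary at
every member above any `M12` and every `α₀ > 0` with `M·α₀ ≤ a12` — F5's `parKnitY_mem_unitary_of_reg335P` ([5] Prop. 2 at the retraction to the double block).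
[cite: Balaban1985BackgroundPropagators, (3.19) p.393, (3.24)–(3.25) pp.394–395, (3.35) p.396; Balaban1985Averaging, Prop. 2 (52)–(53) p.26] -/
theorem hparK_knit_of_pinsR
    (hRP1 : ∀ (x : MemberY θ.d₆ θ.ℓ₆ θ.hd' θ.hL' θ.b₀ θ.b₁ Mstar) (α₀ : ℝ) (U : (bg9YR (Matrix (Fin N) (Fin N) ℂ) (specialUnitaryUnits (Fin N)) R₁ R₂ x).Cfg),
      (bg9YR (Matrix (Fin N) (Fin N) ℂ) (specialUnitaryUnits (Fin N)) R₁ R₂ x).Reg335 c α₀ U →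
        0 ≤ α₀ ∧ (bg9YP (Matrix (Fin N) (Fin N) ℂ) (specialUnitaryUnits (Fin N)) x).Reg335 c35Y α₀ U)
    {M12 a12 α₀' : ℝ} (hα' : 0 < α₀') (hα3 : C0 (θ.d₆ + 1) * α₀' ≤ 1 / 3) (hα2 : 2 * α₀' ≤ c2' (θ.d₆ + 1) (θ.ℓ₆ + 1))
    (hKpl : ∀ (x : MemberY θ.d₆ θ.ℓ₆ θ.hd' θ.hL' θ.b₀ θ.b₁ Mstar) (a : ℝ), 0 ≤ a → a ≤ a12 → Kpl x.toKIdx a * (kGeo x.toKIdx).L ^ 4 < α₀') :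
    ∀ x : MemberY θ.d₆ θ.ℓ₆ θ.hd' θ.hL' θ.b₀ θ.b₁ Mstar, M12 ≤ (geo9Y x).M → ∀ α₀ : ℝ, 0 < α₀ → (geo9Y x).M * α₀ ≤ a12 →
      ∀ U : (bg9YR (Matrix (Fin N) (Fin N) ℂ) (specialUnitaryUnits (Fin N)) R₁ R₂ x).Cfg, (bg9YR (Matrix (Fin N) (Fin N) ℂ) (specialUnitaryUnits (Fin N)) R₁ R₂ x).Reg335 c α₀ U →
        ∀ z w : SiteY x.toKIdx, parKnitY x.toKIdx U z w ∈ B7Prop2Explicit.unitaryUnits (Matrix (Fin N) (Fin N) ℂ) := by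
  intro x _ α₀ hα ha U hU z w
  have hMα : 0 ≤ (kGeo x.toKIdx).M * α₀ := kGeo_M_mul_nonneg x.toKIdx hα.le
  have hK : Kpl x.toKIdx ((kGeo x.toKIdx).M * α₀) * (kGeo x.toKIdx).L ^ 4 < α₀' :=
    Kpl_mul_L4_lt_of_thresh x.toKIdx (hKpl x ((geo9Y x).M * α₀) hMα ha) hα.le le_rfl
  exact parKnitY_mem_unitary_of_reg335P x.toKIdx
    (fun u hu => (CStarRing.norm_of_mem_unitary (B7Prop2Explicit.mem_unitaryUnits.1 (specialUnitaryUnits_le_unitaryUnits hu))).le)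
    specialUnitaryUnits_le_unitaryUnits U c35Y_eq.le hMα (hRP1 x α₀ U hU).2.1 hα' hα3 hα2 hK z w

/-! ## §2 «KD′»'s `hC1TK` from the member laws, `hΔ2` in the (3.35)-GUARDED shape -/

/-- ★★★ **THE CERTIFICATE's BINDER `hC1T` AT THE KNIT PAIR, `hΔ2` GUARDED** (⚑ LOCATED-30, S1): at any Sect.-D record `𝔬12` whose `C1` is pinned to def-Y's knit model
(`hC1co12`), over `bg9YR … R₁ R₂` with `R₁` SU(N)-valued (`hGR`), the member laws `hparK` (knit legs `U(N)`-valued on the classes) and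
`hΔ2 : ∀ x, M12 ≤ M → ∀ α₀ > 0, M·α₀ ≤ a12 → ∀ U, Reg335 c α₀ U → IsSymmTr 1 (Δ⁽²⁾ x U)` (the (3.35)-guarded reality of the knit `Δ⁽²⁾`, «KD′»'s display) give
`hC1TK` VERBATIM: `C₁(U) = cR39·coordOpK ((𝔮G₁𝔮⋆)⁻¹(U))` at `(qKnitOfRecord, qsKnitOfRecord, parKnitY, G′_phys(parKnitY), Δ⁽²⁾)` is its own counting transpose
(`…ParLawsQ.isTransposePair_C1coKq_knit_of_laws`, def-Y's `QG1QinvQY_GpPhysY_isSymmTr_parKnitY`).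
[cite: Balaban1985BackgroundPropagators, (3.132) p.422, (3.134) p.422, Thm 3.13 p.426, (3.35)–(3.36) p.396, (3.115) p.418; Balaban1985Averaging, Prop. 2 p.26] -/
theorem hC1T_knit_of_lawsG (hGR : MemOfFam (specialUnitaryUnits (Fin N)) R₁)
    {X12 Y12 W12 : MemberY θ.d₆ θ.ℓ₆ θ.hd' θ.hL' θ.b₀ θ.b₁ Mstar → Type} [∀ x, Fintype (X12 x)] [∀ x, Fintype (Y12 x)] [∀ x, Fintype (W12 x)]
    (𝔬12 : ∀ x : MemberY θ.d₆ θ.ℓ₆ θ.hd' θ.hL' θ.b₀ θ.b₁ Mstar, Ops (geo9Y x) (bg9YR (Matrix (Fin N) (Fin N) ℂ) (specialUnitaryUnits (Fin N)) R₁ R₂ x) (X12 x) (Y12 x) (XHK (TrIdx N) x.toKIdx) (W12 x))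
    (Δ2 : ∀ x : MemberY θ.d₆ θ.ℓ₆ θ.hd' θ.hL' θ.b₀ θ.b₁ Mstar, BondOpY (Matrix (Fin N) (Fin N) ℂ) x.toKIdx)
    (hC1co12 : ∀ (x : MemberY θ.d₆ θ.ℓ₆ θ.hd' θ.hL' θ.b₀ θ.b₁ Mstar) (U : (bg9YR (Matrix (Fin N) (Fin N) ℂ) (specialUnitaryUnits (Fin N)) R₁ R₂ x).Cfg),
      (𝔬12 x).C1 U = C1coKq x.toKIdx (trBasis N) (bg9YR (Matrix (Fin N) (Fin N) ℂ) (specialUnitaryUnits (Fin N)) R₁ R₂ x) (fun U => U)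
        (qKnitOfRecord N θ x.toKIdx) (qsKnitOfRecord N θ x.toKIdx) (parKnitY x.toKIdx) (GpPhysY x.toKIdx (parKnitY x.toKIdx)) (Δ2 x) U)
    {M12 a12 : ℝ}
    (hparK : ∀ x : MemberY θ.d₆ θ.ℓ₆ θ.hd' θ.hL' θ.b₀ θ.b₁ Mstar, M12 ≤ (geo9Y x).M → ∀ α₀ : ℝ, 0 < α₀ → (geo9Y x).M * α₀ ≤ a12 →
      ∀ U : (bg9YR (Matrix (Fin N) (Fin N) ℂ) (specialUnitaryUnits (Fin N)) R₁ R₂ x).Cfg, (bg9YR (Matrix (Fin N) (Fin N) ℂ) (specialUnitaryUnits (Fin N)) R₁ R₂ x).Reg335 c α₀ U →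
        ∀ z w : SiteY x.toKIdx, parKnitY x.toKIdx U z w ∈ B7Prop2Explicit.unitaryUnits (Matrix (Fin N) (Fin N) ℂ))
    (hΔ2 : ∀ x : MemberY θ.d₆ θ.ℓ₆ θ.hd' θ.hL' θ.b₀ θ.b₁ Mstar, M12 ≤ (geo9Y x).M → ∀ α₀ : ℝ, 0 < α₀ → (geo9Y x).M * α₀ ≤ a12 →
      ∀ U : (bg9YR (Matrix (Fin N) (Fin N) ℂ) (specialUnitaryUnits (Fin N)) R₁ R₂ x).Cfg, (bg9YR (Matrix (Fin N) (Fin N) ℂ) (specialUnitaryUnits (Fin N)) R₁ R₂ x).Reg335 c α₀ U →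
        IsSymmTr (fun _ => (1 : ℝ)) (Δ2 x U)) :
    ∀ x : MemberY θ.d₆ θ.ℓ₆ θ.hd' θ.hL' θ.b₀ θ.b₁ Mstar, M12 ≤ (geo9Y x).M → ∀ α₀ : ℝ, 0 < α₀ → (geo9Y x).M * α₀ ≤ a12 →
      ∀ U : (bg9YR (Matrix (Fin N) (Fin N) ℂ) (specialUnitaryUnits (Fin N)) R₁ R₂ x).Cfg, (bg9YR (Matrix (Fin N) (Fin N) ℂ) (specialUnitaryUnits (Fin N)) R₁ R₂ x).Reg335 c α₀ U →
        (bg9YR (Matrix (Fin N) (Fin N) ℂ) (specialUnitaryUnits (Fin N)) R₁ R₂ x).Reg336 c α₀ U → IsTransposePair ((𝔬12 x).C1 U) ((𝔬12 x).C1 U) := by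
  intro x hM α₀ hα ha U hU _
  have hUG : ∀ μ z, U μ z ∈ specialUnitaryUnits (Fin N) := mem_of_reg335R hGR x hU
  rw [hC1co12 x U]
  exact isTransposePair_C1coKq_knit_of_laws θ x.toKIdx (bg9YR (Matrix (Fin N) (Fin N) ℂ) (specialUnitaryUnits (Fin N)) R₁ R₂ x) (fun U => U) (Δ2 x) U hUG
    (hparK x hM α₀ hα ha U hU) (hΔ2 x hM α₀ hα ha U hU)

/-- ★★★ **«KD′»'s `hC1TK` FROM ITS OWN BINDERS PLUS THE GUARDED `hΔ2`** — `hparK` discharged by §1: inputs `hGR`, `hC1co12`, `hRP1`, the x-free knit numerics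
`hα′ hα3 hα2` (= «KD′»'s `hαK hαK3 hαK2` at `α₀′ := α₀K`), the member-keyed plaquette threshold `hKpl` for `a ≤ a12` (from «KD′»'s `hKplK` once `a12 ≤ aK`), and
`hΔ2` in the (3.35)-guarded S1 shape. [cite: Balaban1985BackgroundPropagators, (3.132) p.422, (3.134) p.422, Thm 3.13 p.426, (3.19) p.393, (3.35)–(3.36) p.396; Balaban1985Averaging, Prop. 2 (52)–(53) p.26] -/
theorem hC1T_knit_of_pinsG (hGR : MemOfFam (specialUnitaryUnits (Fin N)) R₁)
    {X12 Y12 W12 : MemberY θ.d₆ θ.ℓ₆ θ.hd' θ.hL' θ.b₀ θ.b₁ Mstar → Type} [∀ x, Fintype (X12 x)] [∀ x, Fintype (Y12 x)] [∀ x, Fintype (W12 x)]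
    (𝔬12 : ∀ x : MemberY θ.d₆ θ.ℓ₆ θ.hd' θ.hL' θ.b₀ θ.b₁ Mstar, Ops (geo9Y x) (bg9YR (Matrix (Fin N) (Fin N) ℂ) (specialUnitaryUnits (Fin N)) R₁ R₂ x) (X12 x) (Y12 x) (XHK (TrIdx N) x.toKIdx) (W12 x))
    (Δ2 : ∀ x : MemberY θ.d₆ θ.ℓ₆ θ.hd' θ.hL' θ.b₀ θ.b₁ Mstar, BondOpY (Matrix (Fin N) (Fin N) ℂ) x.toKIdx)
    (hC1co12 : ∀ (x : MemberY θ.d₆ θ.ℓ₆ θ.hd' θ.hL' θ.b₀ θ.b₁ Mstar) (U : (bg9YR (Matrix (Fin N) (Fin N) ℂ) (specialUnitaryUnits (Fin N)) R₁ R₂ x).Cfg),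
      (𝔬12 x).C1 U = C1coKq x.toKIdx (trBasis N) (bg9YR (Matrix (Fin N) (Fin N) ℂ) (specialUnitaryUnits (Fin N)) R₁ R₂ x) (fun U => U)
        (qKnitOfRecord N θ x.toKIdx) (qsKnitOfRecord N θ x.toKIdx) (parKnitY x.toKIdx) (GpPhysY x.toKIdx (parKnitY x.toKIdx)) (Δ2 x) U)
    (hRP1 : ∀ (x : MemberY θ.d₆ θ.ℓ₆ θ.hd' θ.hL' θ.b₀ θ.b₁ Mstar) (α₀ : ℝ) (U : (bg9YR (Matrix (Fin N) (Fin N) ℂ) (specialUnitaryUnits (Fin N)) R₁ R₂ x).Cfg),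
      (bg9YR (Matrix (Fin N) (Fin N) ℂ) (specialUnitaryUnits (Fin N)) R₁ R₂ x).Reg335 c α₀ U →
        0 ≤ α₀ ∧ (bg9YP (Matrix (Fin N) (Fin N) ℂ) (specialUnitaryUnits (Fin N)) x).Reg335 c35Y α₀ U)
    {M12 a12 α₀' : ℝ} (hα' : 0 < α₀') (hα3 : C0 (θ.d₆ + 1) * α₀' ≤ 1 / 3) (hα2 : 2 * α₀' ≤ c2' (θ.d₆ + 1) (θ.ℓ₆ + 1))
    (hKpl : ∀ (x : MemberY θ.d₆ θ.ℓ₆ θ.hd' θ.hL' θ.b₀ θ.b₁ Mstar) (a : ℝ), 0 ≤ a → a ≤ a12 → Kpl x.toKIdx a * (kGeo x.toKIdx).L ^ 4 < α₀')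
    (hΔ2 : ∀ x : MemberY θ.d₆ θ.ℓ₆ θ.hd' θ.hL' θ.b₀ θ.b₁ Mstar, M12 ≤ (geo9Y x).M → ∀ α₀ : ℝ, 0 < α₀ → (geo9Y x).M * α₀ ≤ a12 →
      ∀ U : (bg9YR (Matrix (Fin N) (Fin N) ℂ) (specialUnitaryUnits (Fin N)) R₁ R₂ x).Cfg, (bg9YR (Matrix (Fin N) (Fin N) ℂ) (specialUnitaryUnits (Fin N)) R₁ R₂ x).Reg335 c α₀ U →
        IsSymmTr (fun _ => (1 : ℝ)) (Δ2 x U)) :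
    ∀ x : MemberY θ.d₆ θ.ℓ₆ θ.hd' θ.hL' θ.b₀ θ.b₁ Mstar, M12 ≤ (geo9Y x).M → ∀ α₀ : ℝ, 0 < α₀ → (geo9Y x).M * α₀ ≤ a12 →
      ∀ U : (bg9YR (Matrix (Fin N) (Fin N) ℂ) (specialUnitaryUnits (Fin N)) R₁ R₂ x).Cfg, (bg9YR (Matrix (Fin N) (Fin N) ℂ) (specialUnitaryUnits (Fin N)) R₁ R₂ x).Reg335 c α₀ U →
        (bg9YR (Matrix (Fin N) (Fin N) ℂ) (specialUnitaryUnits (Fin N)) R₁ R₂ x).Reg336 c α₀ U → IsTransposePair ((𝔬12 x).C1 U) ((𝔬12 x).C1 U) :=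
  hC1T_knit_of_lawsG θ Mstar hGR 𝔬12 Δ2 hC1co12 (hparK_knit_of_pinsR θ Mstar hRP1 (M12 := M12) hα' hα3 hα2 hKpl) hΔ2

/-! ## §3 At a residual record `𝔯 : ResY N θ M⋆` (`Δ2 := fun x => (𝔯 x).Δ2`): «KD′»'s binder texts `hC1co12 ∕ hΔ2 ∕ hC1TK` verbatim -/

/-- ★★★ **«KD′»'s `hC1TK` AT A RESIDUAL RECORD `𝔯`, ONE NAMED-ARGUMENT APPLICATION FOR «KE»**: `hC1co12` and `hΔ2` in the literal texts of
`…N06AtOpsYSectEStKnitSectDKDG.t312_t313_opsYSectESt_knit_KDG` (`(𝔯 x).Δ2`), conclusion = its `hC1TK`; record inhabitant of `hΔ2` = def-Y's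
`resYOfRecordPK_Δ2_isSymmTr_SU_threshK` through `hRP1` (at `𝔯 := resYOfRecordPK`). [cite: Balaban1985BackgroundPropagators, (3.132) p.422, (3.134) p.422, Thm 3.13 p.426, (3.35)–(3.36) p.396; Balaban1985Averaging, Prop. 2 p.26] -/
theorem hC1T_knit_of_pinsG_res (hGR : MemOfFam (specialUnitaryUnits (Fin N)) R₁)
    {X12 Y12 W12 : MemberY θ.d₆ θ.ℓ₆ θ.hd' θ.hL' θ.b₀ θ.b₁ Mstar → Type} [∀ x, Fintype (X12 x)] [∀ x, Fintype (Y12 x)] [∀ x, Fintype (W12 x)]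
    (𝔬12 : ∀ x : MemberY θ.d₆ θ.ℓ₆ θ.hd' θ.hL' θ.b₀ θ.b₁ Mstar, Ops (geo9Y x) (bg9YR (Matrix (Fin N) (Fin N) ℂ) (specialUnitaryUnits (Fin N)) R₁ R₂ x) (X12 x) (Y12 x) (XHK (TrIdx N) x.toKIdx) (W12 x))
    (𝔯 : ResY N θ Mstar)
    (hC1co12 : ∀ (x : MemberY θ.d₆ θ.ℓ₆ θ.hd' θ.hL' θ.b₀ θ.b₁ Mstar) (U : (bg9YR (Matrix (Fin N) (Fin N) ℂ) (specialUnitaryUnits (Fin N)) R₁ R₂ x).Cfg),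
      (𝔬12 x).C1 U = C1coKq x.toKIdx (trBasis N) (bg9YR (Matrix (Fin N) (Fin N) ℂ) (specialUnitaryUnits (Fin N)) R₁ R₂ x) (fun U => U)
        (qKnitOfRecord N θ x.toKIdx) (qsKnitOfRecord N θ x.toKIdx) (parKnitY x.toKIdx) (GpPhysY x.toKIdx (parKnitY x.toKIdx)) (𝔯 x).Δ2 U)
    (hRP1 : ∀ (x : MemberY θ.d₆ θ.ℓ₆ θ.hd' θ.hL' θ.b₀ θ.b₁ Mstar) (α₀ : ℝ) (U : (bg9YR (Matrix (Fin N) (Fin N) ℂ) (specialUnitaryUnits (Fin N)) R₁ R₂ x).Cfg),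
      (bg9YR (Matrix (Fin N) (Fin N) ℂ) (specialUnitaryUnits (Fin N)) R₁ R₂ x).Reg335 c α₀ U →
        0 ≤ α₀ ∧ (bg9YP (Matrix (Fin N) (Fin N) ℂ) (specialUnitaryUnits (Fin N)) x).Reg335 c35Y α₀ U)
    {M12 a12 α₀' : ℝ} (hα' : 0 < α₀') (hα3 : C0 (θ.d₆ + 1) * α₀' ≤ 1 / 3) (hα2 : 2 * α₀' ≤ c2' (θ.d₆ + 1) (θ.ℓ₆ + 1))
    (hKpl : ∀ (x : MemberY θ.d₆ θ.ℓ₆ θ.hd' θ.hL' θ.b₀ θ.b₁ Mstar) (a : ℝ), 0 ≤ a → a ≤ a12 → Kpl x.toKIdx a * (kGeo x.toKIdx).L ^ 4 < α₀')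
    (hΔ2 : ∀ x : MemberY θ.d₆ θ.ℓ₆ θ.hd' θ.hL' θ.b₀ θ.b₁ Mstar, M12 ≤ (geo9Y x).M → ∀ α₀ : ℝ, 0 < α₀ → (geo9Y x).M * α₀ ≤ a12 → ∀ U : (bg9YR (Matrix (Fin N) (Fin N) ℂ) (specialUnitaryUnits (Fin N)) R₁ R₂ x).Cfg, (bg9YR (Matrix (Fin N) (Fin N) ℂ) (specialUnitaryUnits (Fin N)) R₁ R₂ x).Reg335 c α₀ U → IsSymmTr (fun _ => (1 : ℝ)) ((𝔯 x).Δ2 U)) :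
    ∀ x : MemberY θ.d₆ θ.ℓ₆ θ.hd' θ.hL' θ.b₀ θ.b₁ Mstar, M12 ≤ (geo9Y x).M → ∀ α₀ : ℝ, 0 < α₀ → (geo9Y x).M * α₀ ≤ a12 → ∀ U : (bg9YR (Matrix (Fin N) (Fin N) ℂ) (specialUnitaryUnits (Fin N)) R₁ R₂ x).Cfg, (bg9YR (Matrix (Fin N) (Fin N) ℂ) (specialUnitaryUnits (Fin N)) R₁ R₂ x).Reg335 c α₀ U → (bg9YR (Matrix (Fin N) (Fin N) ℂ) (specialUnitaryUnits (Fin N)) R₁ R₂ x).Reg336 c α₀ U → IsTransposePair ((𝔬12 x).C1 U) ((𝔬12 x).C1 U) :=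
  hC1T_knit_of_pinsG θ Mstar hGR 𝔬12 (fun x => (𝔯 x).Δ2) hC1co12 hRP1 hα' hα3 hα2 hKpl hΔ2

/-- ★★★ **THE SAME WITH «KD′»'s INDEX-KEYED PLAQUETTE THRESHOLD `hKplK` (`∀ i : KIdx, ∀ a ≤ aK, K_pl(a)·L⁴ < α₀′`) AND `h12K : a12 ≤ aK`** — every argument a «KD′» binder
by name (`hGR 𝔬12 𝔯 hC1co12 hRP1`, `hαK hαK3 hαK2` as `hα′ hα3 hα2`, `hKplK`, `hΔ2`) plus the one threshold comparison `h12K`.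
[cite: Balaban1985BackgroundPropagators, (3.132) p.422, (3.134) p.422, Thm 3.13 p.426, (3.35)–(3.36) p.396; Balaban1985Averaging, Prop. 2 p.26] -/
theorem hC1T_knit_of_pinsG_resK (hGR : MemOfFam (specialUnitaryUnits (Fin N)) R₁)
    {X12 Y12 W12 : MemberY θ.d₆ θ.ℓ₆ θ.hd' θ.hL' θ.b₀ θ.b₁ Mstar → Type} [∀ x, Fintype (X12 x)] [∀ x, Fintype (Y12 x)] [∀ x, Fintype (W12 x)]
    (𝔬12 : ∀ x : MemberY θ.d₆ θ.ℓ₆ θ.hd' θ.hL' θ.b₀ θ.b₁ Mstar, Ops (geo9Y x) (bg9YR (Matrix (Fin N) (Fin N) ℂ) (specialUnitaryUnits (Fin N)) R₁ R₂ x) (X12 x) (Y12 x) (XHK (TrIdx N) x.toKIdx) (W12 x))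
    (𝔯 : ResY N θ Mstar)
    (hC1co12 : ∀ (x : MemberY θ.d₆ θ.ℓ₆ θ.hd' θ.hL' θ.b₀ θ.b₁ Mstar) (U : (bg9YR (Matrix (Fin N) (Fin N) ℂ) (specialUnitaryUnits (Fin N)) R₁ R₂ x).Cfg),
      (𝔬12 x).C1 U = C1coKq x.toKIdx (trBasis N) (bg9YR (Matrix (Fin N) (Fin N) ℂ) (specialUnitaryUnits (Fin N)) R₁ R₂ x) (fun U => U)
        (qKnitOfRecord N θ x.toKIdx) (qsKnitOfRecord N θ x.toKIdx) (parKnitY x.toKIdx) (GpPhysY x.toKIdx (parKnitY x.toKIdx)) (𝔯 x).Δ2 U)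
    (hRP1 : ∀ (x : MemberY θ.d₆ θ.ℓ₆ θ.hd' θ.hL' θ.b₀ θ.b₁ Mstar) (α₀ : ℝ) (U : (bg9YR (Matrix (Fin N) (Fin N) ℂ) (specialUnitaryUnits (Fin N)) R₁ R₂ x).Cfg),
      (bg9YR (Matrix (Fin N) (Fin N) ℂ) (specialUnitaryUnits (Fin N)) R₁ R₂ x).Reg335 c α₀ U →
        0 ≤ α₀ ∧ (bg9YP (Matrix (Fin N) (Fin N) ℂ) (specialUnitaryUnits (Fin N)) x).Reg335 c35Y α₀ U)
    {M12 a12 aK α₀' : ℝ} (hα' : 0 < α₀') (hα3 : C0 (θ.d₆ + 1) * α₀' ≤ 1 / 3) (hα2 : 2 * α₀' ≤ c2' (θ.d₆ + 1) (θ.ℓ₆ + 1))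
    (hKplK : ∀ (i : KIdx θ.d₆ θ.ℓ₆ θ.hd' θ.hL' θ.b₀ θ.b₁) (a : ℝ), 0 ≤ a → a ≤ aK → Kpl i a * (kGeo i).L ^ 4 < α₀') (h12K : a12 ≤ aK)
    (hΔ2 : ∀ x : MemberY θ.d₆ θ.ℓ₆ θ.hd' θ.hL' θ.b₀ θ.b₁ Mstar, M12 ≤ (geo9Y x).M → ∀ α₀ : ℝ, 0 < α₀ → (geo9Y x).M * α₀ ≤ a12 → ∀ U : (bg9YR (Matrix (Fin N) (Fin N) ℂ) (specialUnitaryUnits (Fin N)) R₁ R₂ x).Cfg, (bg9YR (Matrix (Fin N) (Fin N) ℂ) (specialUnitaryUnits (Fin N)) R₁ R₂ x).Reg335 c α₀ U → IsSymmTr (fun _ => (1 : ℝ)) ((𝔯 x).Δ2 U)) :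
    ∀ x : MemberY θ.d₆ θ.ℓ₆ θ.hd' θ.hL' θ.b₀ θ.b₁ Mstar, M12 ≤ (geo9Y x).M → ∀ α₀ : ℝ, 0 < α₀ → (geo9Y x).M * α₀ ≤ a12 → ∀ U : (bg9YR (Matrix (Fin N) (Fin N) ℂ) (specialUnitaryUnits (Fin N)) R₁ R₂ x).Cfg, (bg9YR (Matrix (Fin N) (Fin N) ℂ) (specialUnitaryUnits (Fin N)) R₁ R₂ x).Reg335 c α₀ U → (bg9YR (Matrix (Fin N) (Fin N) ℂ) (specialUnitaryUnits (Fin N)) R₁ R₂ x).Reg336 c α₀ U → IsTransposePair ((𝔬12 x).C1 U) ((𝔬12 x).C1 U) :=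
  hC1T_knit_of_pinsG_res θ Mstar hGR 𝔬12 𝔯 hC1co12 hRP1 hα' hα3 hα2 (fun x a h0 ha => hKplK x.toKIdx a h0 (ha.trans h12K)) hΔ2

end Summit.QuantumFields.YangMills.BalabanUVNodes.N06Thm312313ParLawsQG

end
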